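import Summits.CriticalPhenomena.PercolationContinuityZ3.Theorems.Transplant.KNCellsBoxProdZ2ConcF
import Summits.CriticalPhenomena.PercolationContinuityZ3.Theorems.Transplant.KNCellsBoxProdZ2ConcSchedule
import HarnessLib

/-!
# Design (D) CONCENTRIC — the generated radius schedule as p3-g2's `ConcRadiiF` record, with its well-formedness
# (ENTRY-SEED-STAR §11 v2; refuter's D-CHECKLIST D1)

builds on p205010 (kernel theorem, internal audit signed; external expert review pending) — nothing in this file uses p205010.
Lane `prim-bschramm`, lead seat (gen 2) for p3-g2's I2; helper file (`--supports stmt-CriticalPhenomena-4575`).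
* `concRadiiFOfGap gap gap' E₀ L′ : ConcRadiiF` — `E := Erad`, `F := Frad`, corridor profile `ρ b _ := E (b-1)` (the corridor sets of
  depth `b` carry the radius of the cube they grow from), hand-over cube `rM b := F b - L′`;
* `concRadiiFOfGap_WF : (concRadiiFOfGap gap gap' E₀ L′).WF C` for every planar cell system `C`.
[cite: KozmaNitzan2024, §4 pp. 26–27]
-/

namespace Summit.CriticalPhenomena.PercolationContinuityZ3.Theorems

namespace Transplant

namespace BoxProdZ2

variable (gap gap' : ℕ → ℕ) (E₀ L' : ℕ)

/-- **The concentric two-radius schedule generated by two gap functions**, packaged as `ConcRadiiF`. [this work] -/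
def concRadiiFOfGap : ConcRadiiF where
  E := Erad gap gap' E₀
  F := Frad gap gap' E₀
  ρ := fun b _ => Erad gap gap' E₀ (b - 1)
  rM := fun b => Frad gap gap' E₀ b - L'

/-- `E` of the generated schedule. [this work] -/
@[simp] theorem concRadiiFOfGap_E (b : ℕ) : (concRadiiFOfGap gap gap' E₀ L').E b = Erad gap gap' E₀ b := rfl

/-- `F` of the generated schedule. [this work] -/
@[simp] theorem concRadiiFOfGap_F (b : ℕ) : (concRadiiFOfGap gap gap' E₀ L').F b = Frad gap gap' E₀ b := rfl

/-- `ρ` of the generated schedule (level-independent). [this work] -/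
@[simp] theorem concRadiiFOfGap_ρ (b : ℕ) (ℓ : ℤ) : (concRadiiFOfGap gap gap' E₀ L').ρ b ℓ = Erad gap gap' E₀ (b - 1) := rfl

/-- `rM` of the generated schedule. [this work] -/
@[simp] theorem concRadiiFOfGap_rM (b : ℕ) : (concRadiiFOfGap gap gap' E₀ L').rM b = Frad gap gap' E₀ b - L' := rfl

/-- **Well-formedness** of the generated schedule (the five containments of `ConcRadiiF.WF`). [this work] -/
theorem concRadiiFOfGap_WF (C : PCells) : (concRadiiFOfGap gap gap' E₀ L').WF C where
  mono b := Erad_mono gap gap' E₀ (Nat.le_succ b)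
  ρ_le_F b _ := Erad_pred_le_Frad gap gap' E₀ b
  F_le b := Frad_le_Erad gap gap' E₀ b
  ρ_base _ _ _ := le_rfl
  rM_le_F _ := Nat.sub_le _ _

/-- The hand-over cube has fibre room `L′` inside the far box once `L′ ≤ F b`: `rM b + L′ = F b`. [this work] -/
theorem concRadiiFOfGap_rM_add {b : ℕ} (h : L' ≤ Frad gap gap' E₀ b) :
    (concRadiiFOfGap gap gap' E₀ L').rM b + L' = Frad gap gap' E₀ b := by
  simp [Nat.sub_add_cancel h]

end BoxProdZ2

end Transplant

end Summit.CriticalPhenomena.PercolationContinuityZ3.Theorems
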